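import Literature.Computability.Complexity.KannanLanguage
import Literature.Computability.Complexity.CircuitClassesUniformProofs
import Literature.Computability.Complexity.NSubexp
import HarnessLib

/-!
# A language outside `NP`: Kannan's least hard table, against nondeterministic circuit descriptions

`Literature/Computability/Complexity`. Kannan's diagonal language (Kannan 1982, Lemma 1; `KannanLanguage.lean`:
`Kannan.lang k`, the least truth table beating every circuit description of length `≤ n^{2k+2}`,
proved outside `SIZE(c·nᵏ + c)`) is run here against **nondeterministic** circuits with a
**super-polynomial** budget: at input length `n` the table `T ∈ {0,1}^{2ⁿ}` must differ, on some
`y ∈ {0,1}ⁿ`, from `y ↦ [∃ v ∈ {0,1}^{ℓ(n)}, D accepts y v]` for every description `D` of length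
`≤ m(n)`, where `ℓ(n) = 2^{⌊n/2⌋}`, `m(n) = 2^{n-1}` and "`D` accepts `z`" is `Kannan.descAccepts`
(the string `D` read as a program of the circuit evaluator `CircEval.evalFn`, Arora–Barak 2009,
Thm. 6.18). The language `NKannan.nlang` reads the least such table (`IsMinNHard`) at address
`bitsToNat x`.

Main results (sorry-free):

* `NKannan.exists_circuit_of_mem_NP` — **`NP ⊆ NP/poly` in circuit form**: for `L ∈ NP` there are
  polynomials `p, r` such that for all `n` and `ℓ ≥ p(n)` a `B₂`-circuit of size `≤ r(n)` on
  `n + ℓ` inputs satisfies `x ∈ L ↔ ∃ v ∈ {0,1}^ℓ, C(x v) = 1` (`|x| = n`); from the verifier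
  `V ∈ P ⊆ P/poly` (`P_subset_PPoly_holds`, Arora–Barak Thm. 6.6) through
  `exists_cktSize_boolPair_of_mem_PPoly` and an OR over the witness lengths `j ≤ p(n)`
  (`cktSize_existsFin`);
* `NKannan.exists_isNHard` — the counting lemma (Kannan's Lemma 0 for nondeterministic
  descriptions): hard tables exist as soon as `m(n) + 2 ≤ 2ⁿ` (`Kannan.code_injective` and a
  cardinality comparison `2^{2ⁿ} ≤ 2^{m(n)+1}`);
* `NKannan.nlang_not_mem_NP` — **`nlang ∉ NP`**, unconditionally: a verifier for `nlang` would
  give, at a large length, a description of length `≤ m(n)` nondeterministically accepting exactly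
  the slice read off the least hard table;
* the named fact `NKannan.nlang_mem_DTIME_exp_exp` (`def … : Prop`, not proved in THIS file): the
  routine exhaustive-search upper bound `nlang ∈ DTIME(2^{2^{c n}})` for some `c` (five nested
  bounded searches over the evaluator), the one machine construction separating this file from a
  proof of `DTIME(2^{2^{O(n)}}) ⊄ NP` over Mathlib's `TM2` model. It is PROVED downstream, in
  `NondeterministicKannanSearch.lean` (`NKannan.nlang_mem_DTIME_exp_exp_holds`, through the
  quantifier form of `NondeterministicKannanQuantifiers.lean`), and kept here as a `def` so that
  its users' hypotheses stay stable; with it the barrier fact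
  `Literature.Barriers.PneNP.MCSPKarpHardness` (Murray–Williams 2017, Thm. 1.6;
  `Barriers/PneNP/MCSPHardnessObstructionsProofs.lean`, `MCSPKarpHardness_holds`), which uses
  `nlang` as the seed of a padding argument in place of the nondeterministic time hierarchy, is
  unconditional.

## Design notes

* Full tables of length `2ⁿ` indexed by all `y ∈ {0,1}ⁿ` (Kannan pads short addresses; here the
  budget is below `2ⁿ` anyway), witnesses of one exact length `ℓ(n)` appended to the input
  (`y ++ v`; shorter `NP` certificates are padded with zeros, the circuit ORs over the intended
  lengths), parameters `2^{⌊n/2⌋}`, `2^{n-1}` chosen to be producible by the tree's unary/doubling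
  machines (for the future upper bound) and to satisfy: every polynomial is eventually `≤ ℓ(n)`
  (`exists_forall_eval_le_wit`), `poly(n) · ℓ(n) ≤ m(n)` (`mul_wit_le_budget`, the description of a
  polynomial-size circuit on `n + ℓ(n)` inputs has length `O(poly · ℓ)` by `CircEval.length_desc_le`),
  and `m(n) + 2 ≤ 2ⁿ` (`budget_add_two_le`).
* Mathlib has no circuits/complexity classes; everything rests on the tree's `CktSize` calculus
  (`CircuitComposition.lean`), `KannanLanguage.lean` (descriptions, codes, `bitsOf`) and
  `CircuitClassesProofs.lean` (`pairVec`, circuits on pairs).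

## References

* R. Kannan, *Circuit-size lower bounds and non-reducibility to sparse sets*, Inform. Control 55
  (1982) 40–56: Lemma 0 (counting), Lemma 1 (the least hard circuit/table, `Σ₄ ∩ Π₄`), Lemma 3
  (p. 46: super-polynomial space contains languages without small circuits, by exhaustive
  search) — held (`paper:doi-10-1016-s0019-9958-82-90382-5`).
* R. M. Karp, R. J. Lipton, *Some connections between nonuniform and uniform complexity
  classes*, STOC 1980 (advice classes `C/poly`, nondeterministic circuits).
* S. Arora, B. Barak, *Computational Complexity: A Modern Approach*, CUP 2009, Def. 6.5,
  Thm. 6.6 (`P ⊆ P/poly`), Thm. 6.18 (circuit evaluation), Thm. 6.21 (hard functions exist).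
-/

namespace Literature.Computability.Complexity

namespace NKannan

open Kannan CircEval Nondeterministic Polynomial

/-! ### Unbounded fan-in OR over `B₂` -/

/-- The disjunction of `M + 1` wires costs `M` binary OR gates over `B₂` (a chain).
[cite: Vollmer1999, §1.2] -/
theorem cktSize_existsFin : ∀ M : ℕ,
    CktSize B2 (fun (u : Fin (M + 1) → Bool) (_ : Unit) => decide (∃ j, u j = true)) M
  | 0 => by
    refine (CktSize.proj B2 fun _ : Unit => (0 : Fin 1)).congr fun u _ => ?_
    cases h : u 0 <;> simp [Fin.exists_fin_one, h]
  | M + 1 => by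
    have h1 : CktSize B2 (fun (u : Fin (M + 2) → Bool) =>
        Sum.elim (fun _ : Unit => decide (∃ j : Fin (M + 1), u j.castSucc = true))
          (fun _ : Unit => u (Fin.last (M + 1)))) (M + 0) :=
      ((cktSize_existsFin M).rewire Fin.castSucc).pair
        (CktSize.proj B2 fun _ : Unit => Fin.last (M + 1))
    have h2 := h1.comp (cktSize_or (ι := Unit ⊕ Unit) (.inl ()) (.inr ()))
    refine (h2.of_le (by omega)).congr fun u _ => ?_
    simp only [Sum.elim_inl, Sum.elim_inr]
    cases h : u (Fin.last (M + 1)) <;> simp [Fin.exists_fin_succ', h]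

/-! ### Reading circuits on strings -/

/-- The value of a circuit on `N` inputs at a string (read as a bit vector, missing bits `0`).
[folklore] -/
def evalStr {N : ℕ} (C : Circuit (Fin N)) (w : List Bool) : Bool :=
  C.eval fun i => w.getD i false

/-- On a string of the right length, the description of `C` accepts iff `C` evaluates to `1`
(`Kannan.descAccepts_desc`, transported along `|w| = N`). [cite: AroraBarakCC2009, Thm. 6.18] -/
theorem descAccepts_desc_of_length {N : ℕ} (C : Circuit (Fin N)) (hC : C.IsOver B2)
    (w : List Bool) (hw : w.length = N) : descAccepts (desc C) w = evalStr C w := by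
  subst hw
  rw [descAccepts_desc w C hC, evalStr]
  congr 1
  funext i
  simp [List.getD_eq_getElem?_getD]

/-- Reading the first block of `x ++ v` (`|x| = n`) through `finSumFinEquiv`. [folklore] -/
theorem ofFn_getD_append_left {n ℓ : ℕ} (x v : List Bool) (hx : x.length = n) :
    (List.ofFn fun i : Fin n =>
      (x ++ v).getD ((finSumFinEquiv (Sum.inl i) : Fin (n + ℓ)) : ℕ) false) = x := by
  subst hx
  apply List.ext_getElem (by simp)
  intro i h₁ h₂
  simp only [List.getElem_ofFn, finSumFinEquiv_apply_left, Fin.val_castAdd,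
    List.getD_eq_getElem?_getD]
  rw [List.getElem?_append_left h₂, List.getElem?_eq_getElem h₂]
  rfl

/-- Reading `j ≤ |v|` bits of the second block of `x ++ v` (`|x| = n`, `|v| = ℓ`) through
`finSumFinEquiv`: the prefix `v.take j`. [folklore] -/
theorem ofFn_getD_append_right {n ℓ j : ℕ} (x v : List Bool) (hx : x.length = n)
    (hv : v.length = ℓ) (hj : j ≤ ℓ) :
    (List.ofFn fun i : Fin j =>
      (x ++ v).getD ((finSumFinEquiv (Sum.inr (Fin.castLE hj i)) : Fin (n + ℓ)) : ℕ) false) =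
      v.take j := by
  subst hx
  apply List.ext_getElem (by simp; omega)
  intro i h₁ h₂
  simp only [List.getElem_ofFn, finSumFinEquiv_apply_right, Fin.val_natAdd, Fin.val_castLE,
    List.getD_eq_getElem?_getD, List.getElem_take]
  have hi : i < v.length := by simp at h₁; omega
  rw [List.getElem?_append_right (by omega), Nat.add_sub_cancel_left,
    List.getElem?_eq_getElem hi]
  rfl

/-! ### `NP` languages have polynomial-size nondeterministic circuits -/

/-- **`NP ⊆ NP/poly`, circuit form.** For `L ∈ NP` there are polynomials `p` (witness length)
and `r` (size) such that for every input length `n` and every witness length `ℓ ≥ p(n)` some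
`B₂`-circuit `C` on `n + ℓ` inputs of size `≤ r(n)` satisfies
`x ∈ L ↔ ∃ v ∈ {0,1}^ℓ, C(x v) = 1` for all `x ∈ {0,1}ⁿ`. Construction: the verifier
`V ∈ P ⊆ P/poly` (`P_subset_PPoly_holds`, Arora–Barak 2009, Thm. 6.6) has circuits for the maps
`(x, y) ↦ [⟨x, y⟩ ∈ V]`, `|y| = j` (`exists_cktSize_boolPair_of_mem_PPoly`); the circuit is the
OR over `j ≤ p(n)` of these, the `j`-th fed with the first `j` witness bits (a witness `y` of
length `j ≤ p(n)` is padded with zeros to length `ℓ`). (Karp–Lipton 1980, §1: advice / nonuniform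
classes such as `NP/poly`; the inclusion `NP ⊆ NP/poly` is immediate from the definitions.)
[cite: AroraBarakCC2009, Thm. 6.6 and Def. 6.5] -/
theorem exists_circuit_of_mem_NP {L : Language Bool} (hL : L ∈ NP) :
    ∃ p r : Polynomial ℕ, ∀ n ℓ : ℕ, p.eval n ≤ ℓ →
      ∃ C : Circuit (Fin (n + ℓ)), C.IsOver B2 ∧ C.size ≤ r.eval n ∧
        ∀ x : List Bool, x.length = n →
          (x ∈ L ↔ ∃ v : List Bool, v.length = ℓ ∧ evalStr C (x ++ v) = true) := by
  obtain ⟨V, hV, p, hp⟩ := hL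
  obtain ⟨q, hq⟩ := exists_cktSize_boolPair_of_mem_PPoly (P_subset_PPoly_holds hV)
  refine ⟨p, (p + 1) * (2 * X + 2 + p + q.comp (2 * X + 2 + p)) + p, fun n ℓ hℓ => ?_⟩
  set P := p.eval n with hP
  set s := 2 * n + 2 + P + q.eval (2 * n + 2 + P) with hs
  have hjℓ : ∀ j : Fin (P + 1), (j : ℕ) ≤ ℓ := fun j => (Nat.lt_succ_iff.1 j.2).trans hℓ
  -- the slices `(x, y) ↦ [⟨x, y⟩ ∈ V]`, `|y| = j ≤ P`, on the common inputs `Fin n ⊕ Fin ℓ`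
  have hF : ∀ j : Fin (P + 1), CktSize B2 (fun (w : Fin n ⊕ Fin ℓ → Bool) (_ : Unit) =>
      V.boolIndicator (boolPair (List.ofFn fun i => w (.inl i))
        (List.ofFn fun i : Fin j => w (.inr (Fin.castLE (hjℓ j) i))))) s := by
    intro j
    have h := (hq n j).rewire (ι' := Fin n ⊕ Fin ℓ)
      (Sum.elim Sum.inl fun i : Fin j => Sum.inr (Fin.castLE (hjℓ j) i))
    refine (h.of_le ?_).congr fun w _ => rfl
    have hj : 2 * n + 2 + (j : ℕ) ≤ 2 * n + 2 + P := by have := j.2; omega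
    exact Nat.add_le_add hj (TM2Iter.eval_mono q hj)
  -- their disjunction, as a circuit on `n + ℓ` inputs
  have hG := ((CktSize.pi_fin hF).comp (cktSize_existsFin P)).rewire (ι' := Fin (n + ℓ))
    (fun i => finSumFinEquiv i)
  obtain ⟨C, hCB, hCs, hCe⟩ := hG.toCircuit
  refine ⟨C, hCB, hCs.trans ?_, fun x hx => ?_⟩
  · simp only [Finset.sum_const, Finset.card_univ, Fintype.card_fin, smul_eq_mul, hs, hP]
    simp only [eval_add, eval_mul, eval_one, eval_ofNat, eval_X, eval_comp]
    exact le_rfl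
  · constructor
    · intro hxL
      obtain ⟨y, hy, hyV⟩ := (hp x).1 hxL
      rw [hx] at hy
      refine ⟨y ++ List.replicate (ℓ - y.length) false, by simp; omega, ?_⟩
      rw [evalStr, hCe]
      simp only [decide_eq_true_eq]
      refine ⟨⟨y.length, Nat.lt_succ_of_le hy⟩, ?_⟩
      rw [ofFn_getD_append_left x _ hx, ofFn_getD_append_right x _ hx (by simp; omega) _,
        List.take_left' rfl]
      exact (Set.mem_iff_boolIndicator _ _).1 hyV
    · rintro ⟨v, hv, hCv⟩
      rw [evalStr, hCe] at hCv
      simp only [decide_eq_true_eq] at hCv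
      obtain ⟨j, hj⟩ := hCv
      rw [ofFn_getD_append_left x v hx, ofFn_getD_append_right x v hx hv _] at hj
      refine (hp x).2 ⟨v.take j, ?_, (Set.mem_iff_boolIndicator _ _).2 hj⟩
      rw [List.length_take, hx]
      have := j.2
      omega

/-! ### Parameters, nondeterministic acceptance, hard tables, the language -/

/-- The witness length diagonalised against at input length `n`: `ℓ(n) = 2^{⌊n/2⌋}` (eventually
above every polynomial). [folklore] -/
def wit (n : ℕ) : ℕ := 2 ^ (n / 2)

/-- The description-length budget at input length `n`: `m(n) = 2^{n-1}` (eventually above the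
description length of every polynomial-size circuit on `n + ℓ(n)` inputs, and small enough for
counting: `m(n) + 2 ≤ 2ⁿ` for `n ≥ 2`; note `m(0) = 1` by truncated subtraction — only `n ≥ 2` is
ever used). [cite: Kannan1982, Lemma 1 (proof)] -/
def budget (n : ℕ) : ℕ := 2 ^ (n - 1)

/-- `1 ≤ ℓ(n)`. [folklore] -/
theorem one_le_wit (n : ℕ) : 1 ≤ wit n := Nat.one_le_two_pow

/-- **Nondeterministic acceptance by a description string** at length `n`: the string `D`, read
as a circuit description by the evaluator of `CircuitEval.lean`, accepts `y v` for some witness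
`v ∈ {0,1}^{ℓ(n)}` (Karp–Lipton 1980: nondeterministic circuits; `Kannan.descAccepts`).
[cite: Kannan1982, Lemma 1 (proof)] -/
def NAccepts (n : ℕ) (D y : List Bool) : Prop :=
  ∃ v : List Bool, v.length = wit n ∧ descAccepts D (y ++ v) = true

/-- **`T` is a hard table at length `n`** (nondeterministic form of `Kannan.IsHard`): `T` is a
full truth table, `|T| = 2ⁿ`, and every description `D` of length `≤ m(n)`, used
nondeterministically with witnesses of length `ℓ(n)`, disagrees with `T` on some `y ∈ {0,1}ⁿ`.
[cite: Kannan1982, Lemma 1 (proof, steps (1)–(3))] -/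
def IsNHard (n : ℕ) (T : List Bool) : Prop :=
  T.length = 2 ^ n ∧
    ∀ D : List Bool, D.length ≤ budget n →
      ∃ y : List Bool, y.length = n ∧ ¬ (NAccepts n D y ↔ T.getD (bitsToNat y) false = true)

/-- **`T` is the least hard table at length `n`** (as `Kannan.IsMinHard`): hard, and no hard table
of the same length has smaller binary value. [cite: Kannan1982, Lemma 1 (proof, steps (4)–(6))] -/
def IsMinNHard (n : ℕ) (T : List Bool) : Prop :=
  IsNHard n T ∧ ∀ T' : List Bool, T'.length = 2 ^ n → bitsToNat T' < bitsToNat T → ¬ IsNHard n T'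

/-- **The diagonal language**: `x ∈ L` iff the least hard table at length `|x|` has entry `1` at
address `bitsToNat x`; empty at lengths without hard tables. [cite: Kannan1982, Lemma 1] -/
def nlang : Language Bool :=
  {x | ∃ T : List Bool, IsMinNHard x.length T ∧ T.getD (bitsToNat x) false = true}

/-- Unfolding membership in `nlang`. [cite: Kannan1982, Lemma 1] -/
theorem mem_nlang {x : List Bool} :
    x ∈ nlang ↔ ∃ T : List Bool, IsMinNHard x.length T ∧ T.getD (bitsToNat x) false = true :=
  Iff.rfl

/-- Two least hard tables at the same length coincide. [cite: Kannan1982, Lemma 1 (proof)] -/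
theorem isMinNHard_unique {n : ℕ} {T₁ T₂ : List Bool} (h₁ : IsMinNHard n T₁)
    (h₂ : IsMinNHard n T₂) : T₁ = T₂ := by
  rcases lt_trichotomy (bitsToNat T₁) (bitsToNat T₂) with h | h | h
  · exact absurd h₁.1 (h₂.2 T₁ h₁.1.1 h)
  · exact eq_of_bitsToNat_eq (h₁.1.1.trans h₂.1.1.symm) h
  · exact absurd h₂.1 (h₁.2 T₂ h₂.1.1 h)

/-- If some table is hard, a least hard table exists. [cite: Kannan1982, Lemma 1 (proof)] -/
theorem exists_isMinNHard {n : ℕ} (h : ∃ T, IsNHard n T) : ∃ T, IsMinNHard n T := by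
  classical
  have hP : ∃ v : ℕ, ∃ T, IsNHard n T ∧ bitsToNat T = v := by
    obtain ⟨T, hT⟩ := h
    exact ⟨_, T, hT, rfl⟩
  obtain ⟨T, hT, hv⟩ := Nat.find_spec hP
  refine ⟨T, hT, fun T' _ hlt hT' => ?_⟩
  exact Nat.find_min hP (hv ▸ hlt) ⟨T', hT', rfl⟩

/-- The slice of `nlang` at a length with least hard table `T` is read off `T`.
[cite: Kannan1982, Lemma 1 (proof)] -/
theorem mem_nlang_iff {x T : List Bool} (hT : IsMinNHard x.length T) :
    x ∈ nlang ↔ T.getD (bitsToNat x) false = true := by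
  refine ⟨?_, fun h => ⟨T, hT, h⟩⟩
  rintro ⟨T', hT', h⟩
  rwa [isMinNHard_unique hT' hT] at h

/-! ### Counting: hard tables exist -/

/-- **Counting lemma** (Kannan's Lemma 0, for nondeterministic descriptions): if `m(n) + 2 ≤ 2ⁿ`
then some table of length `2ⁿ` is hard at length `n`. Otherwise every table `ofFn f`,
`f : {0,1}^{2ⁿ}`, agrees with some description `D(f)` of length `≤ m(n)`; `f ↦ code (D f)` is then
an injection of the `2^{2ⁿ}` tables into the `2^{m(n)+1}` padded codes (`Kannan.code_injective`),
impossible. [cite: Kannan1982, Lemma 0] -/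
theorem exists_isNHard (n : ℕ) (hn : budget n + 2 ≤ 2 ^ n) : ∃ T, IsNHard n T := by
  classical
  by_contra hno
  push Not at hno
  have hmatch : ∀ f : Fin (2 ^ n) → Bool, ∃ D : List Bool, D.length ≤ budget n ∧
      ∀ y : List Bool, y.length = n →
        (NAccepts n D y ↔ (List.ofFn f).getD (bitsToNat y) false = true) := by
    intro f
    have h := hno (List.ofFn f)
    simp only [IsNHard, List.length_ofFn, true_and, not_forall, not_exists, not_and, not_not,
      exists_prop] at h
    obtain ⟨D, hD, hagree⟩ := h
    exact ⟨D, hD, fun y hy => hagree y hy⟩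
  choose D hD hagree using hmatch
  let G : (Fin (2 ^ n) → Bool) → (Fin (budget n + 1) → Bool) := fun f => code (budget n) (D f)
  have hG : Function.Injective G := by
    intro f₁ f₂ hf
    have hDD : D f₁ = D f₂ := code_injective (hD f₁) (hD f₂) hf
    funext ⟨i, hi⟩
    have hy : (bitsOf n i).length = n := by simp
    have a₁ := hagree f₁ (bitsOf n i) hy
    have a₂ := hagree f₂ (bitsOf n i) hy
    rw [bitsToNat_bitsOf n i hi, getD_ofFn _ hi] at a₁ a₂
    rw [hDD] at a₁
    rw [Bool.eq_iff_iff, ← a₁, ← a₂]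
  have hcard := Fintype.card_le_of_injective G hG
  simp only [Fintype.card_fun, Fintype.card_bool, Fintype.card_fin] at hcard
  have := (Nat.pow_le_pow_iff_right (by norm_num)).1 hcard
  omega

/-! ### Growth bookkeeping -/

/-- Every polynomial is eventually below `2^{⌊n/2⌋}`. [folklore] -/
theorem exists_forall_eval_le_wit (p : Polynomial ℕ) : ∃ N : ℕ, ∀ n, N ≤ n → p.eval n ≤ wit n := by
  obtain ⟨c, d, hcd⟩ := exists_eval_le_mul_pow_add p
  obtain ⟨C, hC⟩ := TimeConstructible.exists_pow_le_mul_two_pow (d + 1)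
  set K := 2 * c * 3 ^ d with hK
  refine ⟨2 * (K * C + 1), fun n hn => ?_⟩
  set m := n / 2 with hm
  have hm1 : K * C + 1 ≤ m := by omega
  have hm0 : 1 ≤ m := by omega
  have hn3 : n ≤ 3 * m := by omega
  have h1 : p.eval n ≤ K * m ^ d := by
    calc p.eval n ≤ c * n ^ d + c := hcd n
      _ ≤ c * n ^ d + c * n ^ d := by
          have : 1 ≤ n ^ d := Nat.one_le_pow _ _ (by omega)
          nlinarith
      _ = 2 * c * n ^ d := by ring
      _ ≤ 2 * c * (3 * m) ^ d := by gcongr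
      _ = K * m ^ d := by rw [hK, mul_pow]; ring
  have h2 : K * m ^ d * m ≤ m * 2 ^ m := by
    calc K * m ^ d * m = K * m ^ (d + 1) := by ring
      _ ≤ K * (C * 2 ^ m) := Nat.mul_le_mul_left _ (hC m)
      _ = (K * C) * 2 ^ m := by ring
      _ ≤ m * 2 ^ m := Nat.mul_le_mul_right _ (by omega)
  have h3 : K * m ^ d ≤ 2 ^ m := Nat.le_of_mul_le_mul_right (by simpa [mul_comm] using h2) hm0
  exact h1.trans h3

/-- Counting is available from length `2` on: `m(n) + 2 ≤ 2ⁿ`. [folklore] -/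
theorem budget_add_two_le {n : ℕ} (hn : 2 ≤ n) : budget n + 2 ≤ 2 ^ n := by
  obtain ⟨k, rfl⟩ : ∃ k, n = k + 2 := ⟨n - 2, by omega⟩
  have hk : k + 2 - 1 = k + 1 := by omega
  rw [budget, hk, pow_succ, pow_succ, pow_succ]
  have : 1 ≤ 2 ^ k := Nat.one_le_two_pow
  omega

/-- From `2A ≤ ℓ(n)` to `A · ℓ(n) ≤ m(n)` (`ℓ(n)² ≤ 2ⁿ`). [folklore] -/
theorem mul_wit_le_budget {A n : ℕ} (hn : 1 ≤ n) (hA : 2 * A ≤ wit n) : A * wit n ≤ budget n := by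
  have h1 : A * wit n * 2 ≤ wit n * wit n := by nlinarith
  have h2 : wit n * wit n ≤ 2 ^ n := by
    rw [wit, ← pow_add]
    exact Nat.pow_le_pow_right Nat.two_pos (by omega)
  have h3 : 2 ^ n = budget n * 2 := by
    rw [budget, ← pow_succ]
    congr 1
    omega
  nlinarith

/-! ### The language is not in `NP` -/

/-- **`nlang ∉ NP`.** If it were, `exists_circuit_of_mem_NP` would give, at a large length `n`
(witness polynomial `≤ ℓ(n)`, description length of the circuit `≤ m(n)`, `m(n) + 2 ≤ 2ⁿ`), a
description `D = desc C` of length `≤ m(n)` accepting nondeterministically exactly the slice of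
`nlang`, i.e. agreeing with the least hard table everywhere — against hardness. (Kannan's
diagonalization, Lemma 1, run against nondeterministic instead of deterministic circuits; the
uniform upper bound — Kannan's `Σ₄ᵖ`, here double-exponential time — is not part of this
statement.) [cite: Kannan1982, Lemma 1] -/
theorem nlang_not_mem_NP : nlang ∉ NP := by
  intro hL
  obtain ⟨p, r, hC⟩ := exists_circuit_of_mem_NP hL
  obtain ⟨N₁, hN₁⟩ := exists_forall_eval_le_wit p
  obtain ⟨N₂, hN₂⟩ := exists_forall_eval_le_wit (2 * (8 * (r + 1) + (r + 1) * (8 * (X + r) + 10)))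
  set n := max (max N₁ N₂) 2 with hn
  have hn1 : N₁ ≤ n := by omega
  have hn2 : N₂ ≤ n := by omega
  have hn0 : 2 ≤ n := by omega
  obtain ⟨C, hCB, hCs, hCiff⟩ := hC n (wit n) (hN₁ n hn1)
  -- the description of `C` fits the budget
  set R := r.eval n with hR
  have hA : 2 * (8 * (R + 1) + (R + 1) * (8 * (n + R) + 10)) ≤ wit n := by
    have := hN₂ n hn2
    simpa [eval_add, eval_mul, eval_ofNat, eval_X, eval_one, hR] using this
  have hD : (desc C).length ≤ budget n := by
    refine (length_desc_le_of_size_le C hCs).trans ?_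
    refine le_trans ?_ (mul_wit_le_budget (by omega) hA)
    have hw := one_le_wit n
    have h1 : (R + 1) * (8 * (n + R) + 10) ≤ (R + 1) * (8 * (n + R) + 10) * wit n :=
      Nat.le_mul_of_pos_right _ hw
    calc (R + 1) * (8 * (n + wit n + R) + 10)
        = (R + 1) * (8 * (n + R) + 10) + 8 * (R + 1) * wit n := by ring
      _ ≤ (R + 1) * (8 * (n + R) + 10) * wit n + 8 * (R + 1) * wit n := by omega
      _ = (8 * (R + 1) + (R + 1) * (8 * (n + R) + 10)) * wit n := by ring
  -- the least hard table at length `n` is matched by `desc C`: contradiction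
  obtain ⟨T, hT⟩ := exists_isMinNHard (exists_isNHard n (budget_add_two_le hn0))
  obtain ⟨y, hy, hne⟩ := hT.1.2 (desc C) hD
  apply hne
  rw [← mem_nlang_iff (hy.symm ▸ hT), hCiff y hy, NAccepts]
  constructor
  · rintro ⟨v, hv, h⟩
    refine ⟨v, hv, ?_⟩
    rwa [descAccepts_desc_of_length C hCB _ (by simp [hy, hv])] at h
  · rintro ⟨v, hv, h⟩
    refine ⟨v, hv, ?_⟩
    rwa [descAccepts_desc_of_length C hCB _ (by simp [hy, hv])]

/-- Hence a language outside `NP` with an explicit elementary definition (least hard truth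
tables), for use as the seed of padding arguments. [cite: Kannan1982, Lemma 1] -/
theorem exists_not_mem_NP : ∃ L : Language Bool, L ∉ NP := ⟨nlang, nlang_not_mem_NP⟩

/-! ### The uniform upper bound (named fact) -/

/-- **`nlang ∈ DTIME(2^{2^{c n}})` for some `c`** — the exhaustive-search upper bound for the
diagonal language: on input `x`, `|x| = n`, enumerate the tables `T ∈ {0,1}^{2ⁿ}` in increasing
binary value; for each, decide hardness by enumerating the descriptions `D` (`|D| ≤ 2^{n-1}`), the
addresses `y ∈ {0,1}ⁿ` and the witnesses `v ∈ {0,1}^{ℓ(n)}` and running the polynomial-time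
evaluator `CircEval.evalFn` on `⟨y v, D⟩`; answer with the entry of the first hard table at
`bitsToNat x` (reject if none). The count is `2^{2ⁿ} · 2^{2^{n-1}+1} · 2ⁿ · 2^{ℓ(n)} · poly(2ⁿ)
≤ 2^{2^{3n}}` steps for large `n`. This is the tree's own resource bound for its own language, not a
statement printed by Kannan, whose analogous exhaustive diagonalization (the "voting" machine of
the proof sketch of Lemma 3, p. 47) is space-bounded, with running time "at least `2^{2^{√f(n)}}`"
(loc. cit.) — cited for comparison only. Named fact (`def … : Prop`), PROVED downstream:
`NKannan.nlang_mem_DTIME_exp_exp_holds` (`NondeterministicKannanSearch.lean`; kept a `def` here so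
that hypotheses `(h : nlang_mem_DTIME_exp_exp)` of its users stay stable).
[cite: Kannan1982, Lemma 3 (proof sketch, p. 47; cf. only)] -/
def nlang_mem_DTIME_exp_exp : Prop :=
  ∃ c : ℕ, nlang ∈ DTIME (fun n => 2 ^ (2 ^ (c * n)))

end NKannan

end Literature.Computability.Complexity
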